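import Summits.CriticalPhenomena.PercolationContinuityZ3.Theorems.PercNearOneGluingNoHeavyQuantDECOneLow
import Summits.CriticalPhenomena.PercolationContinuityZ3.Theorems.PercNearOneGluingNoHeavyQuantResidDEC
import Summits.CriticalPhenomena.PercolationContinuityZ3.Theorems.PercNearOneGluingNoHeavyQuantRootScaledHeavyRoots
import HarnessLib

/-!
# QUANT lane R8, T-DEC: THE COUNT-LEVEL CERTIFICATE FORMAT FOR `ResidDEC` — finitely many floor-heavy credit PAIRS plus a NO-LOW REMAINDER
# of mean `≥ T` certify `DECAtT y T j′ M μ` at every layer; for the residual this is `ResidDECAt x a L` (README V431's target) (census-1 gen 24)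

builds on p205010 (kernel theorem, internal audit signed; external expert review pending)

Support file (`--supports stmt-CriticalPhenomena-4575`), QUANT lane seat prim-quant-census-1 (gen 24); memo
`run/shared/lean/prim/quant/prim-quant-census-1/RESID-DEC-G24.md` §3.  Theorems only (no definitions, no `@[conjecture]`), standard axioms, no
sorries.  Sequel of this seat's `…QuantDECOneLow` (`decAtT_all_pair`, `decAtT_all_of_noLow_target`, the one-pair case `decAtT_all_of_oneLow`);
uses typer g22's `decAtT_finite_mixture` and typer g41's `ResidDECAt` (`…QuantResidDEC`).

WHY.  The census of RESID-DEC-G24 §2 (19 217 exact instances, 0 failures) produces, for every forest and outer gate, a certificate of ONE shape: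
the low atoms `0 < lo < T/2` of the residual are shipped through finitely many pairs `{loᵢ, hiᵢ; gᵢ}` with `gᵢ ≥ y` and credit
`2·loᵢ + (hiᵢ − loᵢ)·gᵢ ≥ T` (valid at EVERY layer), and what remains — the atom `0`, the untouched self-sufficient atoms and the unused partner
mass — is a law with no positive low atom whose mean is `≥ T`, DEC at the target at every layer by the first-moment criterion.  This file states
that format once, so that certificates found by an LP (this seat's `code-g24/decinf.py`; typer g41's JSON → Lean pipeline) land as instances of
`ResidDECAt` with no per-instance reasoning:
* **`decAtT_all_of_pairs_noLow`**: `μ = Σᵢ λᵢ·{loᵢ, hiᵢ; gᵢ} + λ₀·ν` pointwise (`λ ≥ 0`, `Σᵢ λᵢ + λ₀ = 1`), every charged pair floor-heavy with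
  credit (`loᵢ < hiᵢ ≤ M`, `0 ≤ gᵢ ≤ 1`, `y ≤ gᵢ`, `T ≤ 2·loᵢ + (hiᵢ − loᵢ)·gᵢ`), and — if `λ₀ > 0` — `ν ≥ 0` on `{0..M}` of mass `1`, mean `≥ T`,
  with no charged positive atom below `T/2`, `y·M ≤ T`; then `DECAtT y T j′ M μ` for every `j′` (`0 < y < 1`, `0 < T`).
* **`decAt_all_of_pairs_noLow`** (at the mean), **`residDECAt_of_pairs_noLow`** (the residual `resid a (wco a L) L` at floor `a·x`, target
  `a·fmean L`, top `ftop L` ⟹ `ResidDECAt x a L`).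

HONEST STATUS: certificate format only; `ResidDEC`, `SiblingStep`, `GateStepN`, `FarTreeRow` OPEN; RATE class log\* / honest sentence of
`run/shared/lean/prim/quant/README.md` unchanged.  [this work]; finite mixtures: prim-quant-stmt g22; node of record: prim-quant-lead g47 (V431) /
prim-quant-stmt g41.  Nothing here is cited as a published result.  The gluing rows served [cite: KozmaNitzan2024, Conjecture 3 (p. 15)]; product
measure [cite: Grimmett1999, §1.3 p. 10].
-/

noncomputable section

open scoped BigOperators

namespace Summit.CriticalPhenomena.PercolationContinuityZ3.Theorems
namespace Quant

open Finset

/-- the two-point law `{lo, hi; g}` (as in `…QuantLawDEC`) -/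
local notation3 "TP[" lo ", " hi ", " g ", " h "]" =>
  (g : ℝ) * (if (h : ℕ) = (hi : ℕ) then (1 : ℝ) else 0) + (1 - (g : ℝ)) * (if (h : ℕ) = (lo : ℕ) then (1 : ℝ) else 0)

namespace LawDec

/-- **PAIRS + NO-LOW REMAINDER ⟹ DEC AT THE TARGET AT EVERY LAYER.**  See the file header. [this work] -/
theorem decAtT_all_of_pairs_noLow {ι : Type} [Fintype ι] (y T : ℝ) (M : ℕ) (μ ν : ℕ → ℝ) (lam : ι → ℝ) (lam0 : ℝ)
    (lo hi : ι → ℕ) (g : ι → ℝ) (hy0 : 0 < y) (hy1 : y < 1) (hT : 0 < T)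
    (hlam : ∀ i, 0 ≤ lam i) (hlam0 : 0 ≤ lam0) (hsum : ∑ i, lam i + lam0 = 1)
    (hpair : ∀ i, 0 < lam i → lo i < hi i ∧ hi i ≤ M ∧ 0 ≤ g i ∧ g i ≤ 1 ∧ y ≤ g i ∧
      T ≤ 2 * (lo i : ℝ) + ((hi i : ℝ) - lo i) * g i)
    (hν : 0 < lam0 → (∀ h, 0 ≤ ν h) ∧ (∀ h, M < h → ν h = 0) ∧ (∑ h ∈ Finset.range (M + 1), ν h = 1) ∧
      (∀ h, 1 ≤ h → 0 < ν h → T ≤ 2 * (h : ℝ)) ∧ y * (M : ℝ) ≤ T ∧ T ≤ ∑ h ∈ Finset.range (M + 1), (h : ℝ) * ν h)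
    (hμ : ∀ h, μ h = ∑ i, lam i * TP[lo i, hi i, g i, h] + lam0 * ν h) :
    ∀ j', DECAtT y T j' M μ := by
  classical
  intro j'
  refine decAtT_finite_mixture (ι := Option ι) y T j' M μ (fun o => o.elim lam0 lam)
    (fun o => o.elim ν (fun i h => TP[lo i, hi i, g i, h])) (fun o => ?_) ?_ (fun h => ?_) (fun o ho => ?_)
  · cases o with
    | none => exact hlam0
    | some i => exact hlam i
  · rw [Fintype.sum_option]
    simp only [Option.elim]
    linarith [hsum]
  · rw [hμ h, Fintype.sum_option]
    simp only [Option.elim]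
    ring
  · cases o with
    | none =>
      obtain ⟨hν0, hνM, hν1, hνbig, hta, hνmean⟩ := hν ho
      exact decAtT_all_of_noLow_target y T M ν hy0 hy1 hT hν0 hνM hν1 hνbig hta hνmean j'
    | some i =>
      obtain ⟨hlt, hhi, hg0, hg1, hyg, hcr⟩ := hpair i ho
      exact decAtT_all_pair y T M (lo i) (hi i) (g i) hlt hhi hg0 hg1 hyg hcr j'

/-- **PAIRS + NO-LOW REMAINDER ⟹ DEC AT EVERY LAYER** (at the mean `T` of `μ` on `{0..M}`). [this work] -/
theorem decAt_all_of_pairs_noLow {ι : Type} [Fintype ι] (y T : ℝ) (M : ℕ) (μ ν : ℕ → ℝ) (lam : ι → ℝ) (lam0 : ℝ)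
    (lo hi : ι → ℕ) (g : ι → ℝ) (hy0 : 0 < y) (hy1 : y < 1) (hT : 0 < T)
    (hmean : ∑ h ∈ Finset.range (M + 1), (h : ℝ) * μ h = T)
    (hlam : ∀ i, 0 ≤ lam i) (hlam0 : 0 ≤ lam0) (hsum : ∑ i, lam i + lam0 = 1)
    (hpair : ∀ i, 0 < lam i → lo i < hi i ∧ hi i ≤ M ∧ 0 ≤ g i ∧ g i ≤ 1 ∧ y ≤ g i ∧
      T ≤ 2 * (lo i : ℝ) + ((hi i : ℝ) - lo i) * g i)
    (hν : 0 < lam0 → (∀ h, 0 ≤ ν h) ∧ (∀ h, M < h → ν h = 0) ∧ (∑ h ∈ Finset.range (M + 1), ν h = 1) ∧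
      (∀ h, 1 ≤ h → 0 < ν h → T ≤ 2 * (h : ℝ)) ∧ y * (M : ℝ) ≤ T ∧ T ≤ ∑ h ∈ Finset.range (M + 1), (h : ℝ) * ν h)
    (hμ : ∀ h, μ h = ∑ i, lam i * TP[lo i, hi i, g i, h] + lam0 * ν h) :
    ∀ j', DECAt y j' M μ := by
  intro j'
  rw [decAt_iff_decAtT, hmean]
  exact decAtT_all_of_pairs_noLow y T M μ ν lam lam0 lo hi g hy0 hy1 hT hlam hlam0 hsum hpair hν hμ j'

/-- **A PAIRS + NO-LOW CERTIFICATE OF THE RESIDUAL IS A `ResidDECAt` CERTIFICATE** (README V431's target): tree-OK siblings at floor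
`0 < x < 1`, at least two of them, `0 < a < 1`; the residual `resid a (wco a L) L` (mean `a·fmean L` on `{0..ftop L}`) written as pairs floor-heavy
at `a·x` with credit `≥ a·fmean L` plus a no-low remainder of mean `≥ a·fmean L` ⟹ `ResidDECAt x a L`. [this work] -/
theorem residDECAt_of_pairs_noLow {ι : Type} [Fintype ι] {x a : ℝ} (hx0 : 0 < x) (hx1 : x < 1) (ha0 : 0 < a) (ha1 : a < 1)
    (L : List Sib) (hL : ∀ s ∈ L, s.TreeOK x) (hk : 2 ≤ L.length)
    (ν : ℕ → ℝ) (lam : ι → ℝ) (lam0 : ℝ) (lo hi : ι → ℕ) (g : ι → ℝ)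
    (hlam : ∀ i, 0 ≤ lam i) (hlam0 : 0 ≤ lam0) (hsum : ∑ i, lam i + lam0 = 1)
    (hpair : ∀ i, 0 < lam i → lo i < hi i ∧ hi i ≤ ftop L ∧ 0 ≤ g i ∧ g i ≤ 1 ∧ a * x ≤ g i ∧
      a * fmean L ≤ 2 * (lo i : ℝ) + ((hi i : ℝ) - lo i) * g i)
    (hν : 0 < lam0 → (∀ h, 0 ≤ ν h) ∧ (∀ h, ftop L < h → ν h = 0) ∧ (∑ h ∈ Finset.range (ftop L + 1), ν h = 1) ∧
      (∀ h, 1 ≤ h → 0 < ν h → a * fmean L ≤ 2 * (h : ℝ)) ∧ a * fmean L ≤ ∑ h ∈ Finset.range (ftop L + 1), (h : ℝ) * ν h)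
    (hμ : ∀ h, resid a (wco a L) L h = ∑ i, lam i * TP[lo i, hi i, g i, h] + lam0 * ν h) :
    ResidDECAt x a L := by
  have hL' : ∀ s ∈ L, s.LawOK := fun s hs => (hL s hs).lawOK
  obtain ⟨_, hw, hw1⟩ := wco_admissible ha1 L hL hk
  obtain ⟨_, _, _, rmn⟩ := resid_laws ha0 ha1.le L hL' hw hw1
  have hne : L ≠ [] := by rintro rfl; simp at hk
  have hT : 0 < a * fmean L := mul_pos ha0 ((fmean_pos L hL).2 hne)
  have hta : a * x * (ftop L : ℝ) ≤ a * fmean L := by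
    rw [mul_assoc]; exact mul_le_mul_of_nonneg_left (ftop_mul_floor_le_fmean hx0 hx1 L hL) ha0.le
  intro j _
  exact decAt_all_of_pairs_noLow (a * x) (a * fmean L) (ftop L) (resid a (wco a L) L) ν lam lam0 lo hi g (mul_pos ha0 hx0)
    (by nlinarith) hT rmn hlam hlam0 hsum hpair
    (fun h0 => by obtain ⟨h1, h2, h3, h4, h5⟩ := hν h0; exact ⟨h1, h2, h3, h4, hta, h5⟩) hμ j

end LawDec
end Quant
end Summit.CriticalPhenomena.PercolationContinuityZ3.Theorems
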